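import Mathlib
import HarnessLib
import Literature.MathematicalPhysics.QuantumFieldTheory.YangMillsOS
import Summits.QuantumFields.YangMills.Theses.IsotropyFromPowerCounting

/-!
# Line `degree-split` — crux stmt-QuantumFields-17721 `TemperedCurvatureMoments` (T) (skeleton r5, line-writer seat, 2026-08-31)

HONEST FRAMING (director-ym R645-ym, verbatim obligation). Route IsotropyFromPowerCounting (r4, the only route wanting T) concludes
`YangMills` only through its `WeakCouplingHypercubicLimit`-type existence leg, which stays OPEN and summit-strength; this registered skeleton
is a typed plan for ONE leaf, not progress on the Clay problem; the Yang–Mills mass gap is NOT proved. The hardest stub below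
(`stub_degreeFourUp`) is the Yang–Mills ultraviolet content of T (tempered lattice moment densities in degree ≥ 4 for eventually-wild schemes)
— PARKED, typed, not claimed.

STATE OF THE LEAF (leads c0–c3, item evidence; skeleton of record `Lines/Sketch.lean` reshape 4, 2026-08-17, split BY DEGREE):
* degree 1 LANDED (`DegreeOne.temperedCurvatureMoments_one`, p140708); degree 2 LANDED model-blind (`Sketch.stub_degreeTwo`, p168473);
* degree 3: model-blind analysis GIVEN diagonal product-tensor RP of `S₁` — r4 stubs `stub_chartSelection`, `stub_threeSlotRegularity`,
  `stub_threePointKernel`, `stub_degreeThreeOfKernel` — of which `stub_chartSelection` and `stub_degreeThreeOfKernel` are LANDED as named theorems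
  (`…TemperedCurvatureMomentsChartSelection.lean`, `…DegreeThreeOfKernel.lean`), `stub_threeSlotRegularity` / `stub_threePointKernel` have landed
  support parts (`…ThreeSlotRegularityPart1–2`, `…ThreePointKernelPart1–3`) but no closing theorem in the tree yet — plus `stub_threePointChartBounds`
  (OPEN, QFT → analysis: Gram/Cauchy–Schwarz + planar-cone Cauchy estimates) and `stub_diagonalProductRP` (OPEN, crux-D type — and, like D =
  stmt-10604, plausibly MISSTATED by over-universality for negative-coupling schemes: the same cross-geometry input);
* degree ≥ 4: `stub_shieldedMomentBoundSubseqFour` — the UV content (certified on the frequently-tame sector p163367/p163950; open for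
  eventually-wild schemes) = THE WALL.
All of r4's imports are landed Theorems modules whose hub oleans are UNBUILT today (rc 75 `remote:stale:…:unbuilt`); r4's registered path was a
swept session folder. NOTE: T's conclusion MENTIONS the scheme (`D k x` on `sch`'s lattices), so the coupling trichotomy used for K / Σ does NOT
apply to T (convergence along a subsequence scheme is not convergence along `sch`).

THIS FILE (portable: imports only the route file + `YangMillsOS`) registers r4's degree split at the coarsest honest grain, three stubs with a
kernel-checked case split on the degree:
* `stub_degreeLeTwo`  — T in degrees `n ≤ 2`: CLOSED IN THE TREE (p140708 + p168473); a five-line citation closes it as soon as the hub has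
  rebuilt `…TemperedCurvatureMomentsDegreeTwo` / `…DegreeOne` (proposing that citation is itself what triggers the rebuild). Size S.
* `stub_degreeThree`  — T in degree 3: OPEN modulo r4's six degree-3 stubs (two landed, two with landed parts, `threePointChartBounds` hands-sized,
  `diagonalProductRP` crux-D type). Size L. THIS is where hands go.
* `stub_degreeFourUp` — T in degrees `n ≥ 4`: THE WALL (UV content), parked. Size XL.
`temperedCurvatureMoments_of_children : DegreeLeTwo → DegreeThree → DegreeFourUp → <crux body>` and `TemperedCurvatureMoments_of : TemperedCurvatureMoments` (by name, from the three `stub_*`). `sorry` occurs EXACTLY in the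
three `stub_*`. Negatives (stmt-9665/9494/9599/9603), `Cruxes/TemperedCurvatureMoments/Disproof.lean` and the junk families (p141448: degree-4
rectangles deficient for the span criterion) honoured: no stub claims a model-blind degree-≥4 statement; every stub keeps `W1 ∧ EightFrameRP ∧
PlanarCone` verbatim.
-/

noncomputable section

open scoped BigOperators Topology SchwartzMap
open MeasureTheory Filter Set
open Literature.MathematicalPhysics.QuantumLattice Literature.MathematicalPhysics.AQFT
  Literature.MathematicalPhysics.QuantumFieldTheory Literature.Probability.LatticeModels
  Summit.QuantumFields.YangMills.Theorems.CurvatureBoostCovariance.Negative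
  Summit.QuantumFields.YangMills.Theorems.NPointIsotropy.Negative

namespace Summit.QuantumFields.YangMills.Cruxes.TemperedCurvatureMoments.DegreeSplit

/-! ## The three children (crux body VERBATIM + one hypothesis on the degree `n`) -/

/-- Child `DegreeLeTwo`: T in degrees `n ≤ 2` (closed in the tree: p140708, p168473). [OsterwalderSchrader1973 §4] -/
def DegreeLeTwo : Prop :=
  ∀ (G : Type) [Group G] [TopologicalSpace G] [IsTopologicalGroup G] [CompactSpace G] [MeasurableSpace G] [BorelSpace G], IsCompactSimpleLieGroup G → ∀ (r : LatticeRep G) (sch : SpeciesScheme (YMSpecies G)) (S₁ : SchwingerFamily E4), W1 r sch S₁ → EightFrameRP S₁ → PlanarCone S₁ → ∀ n : ℕ, 0 < n → n ≤ 2 → ∃ (D : ℕ → (Fin n → Site 4) → ℝ) (C : ℝ) (N k₀ : ℕ), 0 < C ∧ (∀ k : ℕ, k₀ ≤ k → ∀ x : Fin n → Site 4, (∀ i, x i ∈ box 4 (sch.L k)) → Function.Injective x → |D k x| ≤ C * (1 + ‖fun i => sch.a k • siteToE (x i)‖) ^ N * (1 + ∑ i, ∑ j ∈ Finset.univ.erase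 i, ‖sch.a k • siteToE (x i) - sch.a k • siteToE (x j)‖⁻¹) ^ N) ∧ ∀ (f : Fin n → SchwartzMap E4 ℝ) (F : SchwartzMap (Fin n → E4) ℂ), IsTensorOf F (fun i => ofRealTest (f i)) → IsOffDiagonal F → Filter.Tendsto (fun k => (((sch.a k ^ 4) ^ n * ∑ x ∈ Fintype.piFinset (fun _ : Fin n => box 4 (sch.L k)), (∏ i, f i (sch.a k • siteToE (x i))) * D k x : ℝ) : ℂ)) Filter.atTop (nhds (S₁ n F))

/-- Child `DegreeThree`: T in degree `n = 3` (open modulo r4's degree-3 stubs). [OsterwalderSchrader1975 §4; GlimmJaffe1987 §6.1, §19.5] -/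
def DegreeThree : Prop :=
  ∀ (G : Type) [Group G] [TopologicalSpace G] [IsTopologicalGroup G] [CompactSpace G] [MeasurableSpace G] [BorelSpace G], IsCompactSimpleLieGroup G → ∀ (r : LatticeRep G) (sch : SpeciesScheme (YMSpecies G)) (S₁ : SchwingerFamily E4), W1 r sch S₁ → EightFrameRP S₁ → PlanarCone S₁ → ∀ n : ℕ, 0 < n → n = 3 → ∃ (D : ℕ → (Fin n → Site 4) → ℝ) (C : ℝ) (N k₀ : ℕ), 0 < C ∧ (∀ k : ℕ, k₀ ≤ k → ∀ x : Fin n → Site 4, (∀ i, x i ∈ box 4 (sch.L k)) → Function.Injective x → |D k x| ≤ C * (1 + ‖fun i => sch.a k • siteToE (x i)‖) ^ N * (1 + ∑ i, ∑ j ∈ Finset.univ.erase i, ‖sch.a k • siteToE (x i) - sch.a k • siteToE (x j)‖⁻¹) ^ N) ∧ ∀ (f : Fin n → SchwartzMap E4 ℝ) (F : SchwartzMap (Fin n → E4) ℂ), IsTensorOf F (fun i => ofRealTest (f i)) → IsOffDiagonal F → Filter.Tendsto (fun k => (((sch.a k ^ 4) ^ n * ∑ x ∈ Fintype.piFinset (fun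 _ : Fin n => box 4 (sch.L k)), (∏ i, f i (sch.a k • siteToE (x i))) * D k x : ℝ) : ℂ)) Filter.atTop (nhds (S₁ n F))

/-- Child `DegreeFourUp`: T in degrees `4 ≤ n` — the Yang–Mills UV content. [Balaban1989LargeFieldII; MagnenRivasseauSeneor1993] -/
def DegreeFourUp : Prop :=
  ∀ (G : Type) [Group G] [TopologicalSpace G] [IsTopologicalGroup G] [CompactSpace G] [MeasurableSpace G] [BorelSpace G], IsCompactSimpleLieGroup G → ∀ (r : LatticeRep G) (sch : SpeciesScheme (YMSpecies G)) (S₁ : SchwingerFamily E4), W1 r sch S₁ → EightFrameRP S₁ → PlanarCone S₁ → ∀ n : ℕ, 0 < n → 4 ≤ n → ∃ (D : ℕ → (Fin n → Site 4) → ℝ) (C : ℝ) (N k₀ : ℕ), 0 < C ∧ (∀ k : ℕ, k₀ ≤ k → ∀ x : Fin n → Site 4, (∀ i, x i ∈ box 4 (sch.L k)) → Function.Injective x → |D k x| ≤ C * (1 + ‖fun i => sch.a k • siteToE (x i)‖) ^ N * (1 + ∑ i, ∑ j ∈ Finset.univ.erase i, ‖sch.a k • siteToE (x i) - sch.a k •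 siteToE (x j)‖⁻¹) ^ N) ∧ ∀ (f : Fin n → SchwartzMap E4 ℝ) (F : SchwartzMap (Fin n → E4) ℂ), IsTensorOf F (fun i => ofRealTest (f i)) → IsOffDiagonal F → Filter.Tendsto (fun k => (((sch.a k ^ 4) ^ n * ∑ x ∈ Fintype.piFinset (fun _ : Fin n => box 4 (sch.L k)), (∏ i, f i (sch.a k • siteToE (x i))) * D k x : ℝ) : ℂ)) Filter.atTop (nhds (S₁ n F))

/-! ## Registered stubs `stub_<name>` (`sorry` lives ONLY here) -/

/-- **stub_degreeLeTwo** (CLOSED IN THE TREE — cite `DegreeOne.temperedCurvatureMoments_one` p140708 and `Sketch.stub_degreeTwo` p168473 once their hub oleans are rebuilt; size S). [OsterwalderSchrader1973 §4] -/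
theorem stub_degreeLeTwo : DegreeLeTwo := by
  sorry

/-- **stub_degreeThree** (OPEN — hands here: r4's `stub_threePointChartBounds` + `stub_diagonalProductRP` are the open inputs; `stub_chartSelection` / `stub_degreeThreeOfKernel` landed, `stub_threeSlotRegularity` / `stub_threePointKernel` have landed parts; size L). [OsterwalderSchrader1975 §4; GlimmJaffe1987 Thm. 6.1.3, Cor. 19.5.6; FrohlichIsraelLiebSimon1978 Thm. 2.1] -/
theorem stub_degreeThree : DegreeThree := by
  sorry

/-- **stub_degreeFourUp** (OPEN — THE WALL: tempered moment densities in degree ≥ 4 for eventually-wild schemes = YM UV content; certified only on the frequently-tame sector p163367/p163950; parked, typed, not claimed; size XL). [Balaban1989LargeFieldII; MagnenRivasseauSeneor1993] -/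
theorem stub_degreeFourUp : DegreeFourUp := by
  sorry

/-! ## Glue (kernel-checked; no `sorry` below this line) -/

/-- **The split, literal form**: the three degree ranges imply the crux body VERBATIM (case split on `n`). [folklore] -/
theorem temperedCurvatureMoments_of_children (hL : DegreeLeTwo) (h3 : DegreeThree) (hH : DegreeFourUp) :
    (∀ (G : Type) [Group G] [TopologicalSpace G] [IsTopologicalGroup G] [CompactSpace G] [MeasurableSpace G] [BorelSpace G], IsCompactSimpleLieGroup G → ∀ (r : LatticeRep G) (sch : SpeciesScheme (YMSpecies G)) (S₁ : SchwingerFamily E4), W1 r sch S₁ → EightFrameRP S₁ → PlanarCone S₁ → ∀ n : ℕ, 0 < n → ∃ (D : ℕ → (Fin n → Site 4) → ℝ) (C : ℝ) (N k₀ : ℕ), 0 < C ∧ (∀ k : ℕ, k₀ ≤ k → ∀ x : Fin n → Site 4, (∀ i, x i ∈ box 4 (sch.L k)) → Function.Injective x → |D k x| ≤ C * (1 + ‖fun i => sch.a k • siteToE (x i)‖) ^ N * (1 + ∑ i, ∑ j ∈ Finset.univ.erase i, ‖sch.a k • siteToE (x i) - sch.a k • siteToE (x j)‖⁻¹) ^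 N) ∧ ∀ (f : Fin n → SchwartzMap E4 ℝ) (F : SchwartzMap (Fin n → E4) ℂ), IsTensorOf F (fun i => ofRealTest (f i)) → IsOffDiagonal F → Filter.Tendsto (fun k => (((sch.a k ^ 4) ^ n * ∑ x ∈ Fintype.piFinset (fun _ : Fin n => box 4 (sch.L k)), (∏ i, f i (sch.a k • siteToE (x i))) * D k x : ℝ) : ℂ)) Filter.atTop (nhds (S₁ n F))) := by
  intro G _ _ _ _ _ _ hG r sch S₁ hW1 h8 hP n hn
  by_cases h2 : n ≤ 2
  · exact hL G hG r sch S₁ hW1 h8 hP n hn h2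
  · by_cases h3' : n = 3
    · exact h3 G hG r sch S₁ hW1 h8 hP n hn h3'
    · exact hH G hG r sch S₁ hW1 h8 hP n hn (by omega)

/-- **Composition `TemperedCurvatureMoments_of`**: the registered stubs `stub_degreeLeTwo → stub_degreeThree → stub_degreeFourUp` give the crux
BY NAME (the ONLY theorem in this file whose conclusion is the crux decl, so the skeleton audit is unambiguous). [folklore] -/
theorem TemperedCurvatureMoments_of : Summit.QuantumFields.YangMills.Theses.IsotropyFromPowerCounting.TemperedCurvatureMoments :=
  temperedCurvatureMoments_of_children stub_degreeLeTwo stub_degreeThree stub_degreeFourUp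

/-- Sanity (each child is WEAKER than the crux): the crux implies all three children. [folklore] -/
theorem children_of_crux (h : Summit.QuantumFields.YangMills.Theses.IsotropyFromPowerCounting.TemperedCurvatureMoments) :
    DegreeLeTwo ∧ DegreeThree ∧ DegreeFourUp := by
  refine ⟨?_, ?_, ?_⟩ <;> intro G _ _ _ _ _ _ hG r sch S₁ hW1 h8 hP n hn _ <;> exact h G hG r sch S₁ hW1 h8 hP n hn

end Summit.QuantumFields.YangMills.Cruxes.TemperedCurvatureMoments.DegreeSplit

end
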